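import Summits.HodgeConjecture.HodgeConjecture.Theorems.K2E3WittLeviCartanTameRamified      -- ★ p856509 (K2E3-p09): §1 tools (`mem_center_wittLevi_of_diagonal'`, `v_coe_wittCoweight_eq`, …); brings ★ ConeCentre
import Summits.HodgeConjecture.HodgeConjecture.Theorems.K2E3WittParabolicBlocksLift        -- ★ (this seat): rows of `W` in a standard indexing (`wittFormOn_apply_inl`)
import HarnessLib

/-!
# Mirror labels and block constancy for `U(σ, wittFormOn e Han)` with ANY anisotropic kernel (`m` arbitrary): the cone × centre tools of ★
# `K2E3WittLeviConeCentre` without `W = J₀` (crux H413, 13a road A′, `m = 2`; W7 part 2a)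

Cell `hodgecm-mathlib`, Track B, line `K2_E3_EllipticInputs`, row 13a; seat K2E3-p10 (g3) (road-A line lead).  THEOREMS ONLY; count-neutral helper
(`--supports stmt-HodgeConjecture-24833 --as helper`).

★ `K2E3WittLeviConeCentre.wittBlockOn_rev` ∕ `const_on_blocks_of_steps` assume `W = J₀` (`hW`), used only to know `W_{k, rev k} ≠ 0` for every `k`; for a
kernel of size `m ≥ 2` the involution `rev` PERMUTES the kernel slots (`rev_apply_inr_inl'`) and `W_{k, rev k}` may vanish there (`Han` diagonal), but the kernel
slots all carry the self-dual label `L`, so the mirror identity `label(rev k) = rev (label k)` survives.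

* `rev_apply_inr_inl'` — `rev (e (u-slot)) = e ((rev u)-slot)` for a standard `e`, any `m`;
* `wittBlockOn_rev'` — mirror labels, any `m`;
* `const_on_blocks_of_steps'` — ★ `const_on_blocks_of_steps` VERBATIM with `hW` deleted (the one use replaced by `wittBlockOn_rev'`).

References: Borel (1991) §23; Bernstein–Zelevinsky (1977) §2.1; Bruhat–Tits (1972) (4.4.3).
-/

set_option autoImplicit false
set_option linter.dupNamespace false

noncomputable section

open scoped Valued WithZero Matrix MatrixGroups
open Matrix

namespace Summit.HodgeConjecture.HodgeConjecture.Cruxes.H413.K2E3WittLeviConeCentreKernel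

open Literature.NumberTheory.Automorphic Literature.NumberTheory.Automorphic.UnitaryGroup Literature.NumberTheory.Automorphic.HermitianLattice
open Literature.NumberTheory.Automorphic.CartanUnique
open K2E3LocalUnitaryWitt K2E3WittStandardIndexing K2E3WittConeContraction K2E3WittCartanUnramified K2E3WittLeviCuspidalDichotomyOfCartan
  K2E3WittLeviCartanBlocks K2E3WittLeviCartanLabels K2E3WittLeviConeCentre K2E3WittLeviCartanRecursionTame K2E3WittLeviCartanTameRamified
  K2E3WittParabolicBlocks K2E3WittParabolicBlocksLift

/-! ## §1 Mirror labels for any kernel -/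

section Group

variable {K : Type*} [Field K] {N r m : ℕ} (e : WittIndex r m ≃ Fin N) (Han : Matrix (Fin m) (Fin m) K) (S : Finset (Fin r))

/-- **`rev` permutes the kernel slots of a standard indexing**: `rev (e (u-slot)) = e ((rev u)-slot)` (any `m`; for `m ≤ 1` this is ★ `rev_apply_inr_inl`).
[cite: Borel1991, §23] -/
theorem rev_apply_inr_inl'
    (hstd : ∀ x, (e x).val = Sum.elim (fun i : Fin r => i.val) (Sum.elim (fun u : Fin m => r + u.val) (fun j : Fin r => r + m + j.val)) x) (u : Fin m) :
    Fin.rev (e (Sum.inr (Sum.inl u))) = e (Sum.inr (Sum.inl (Fin.rev u))) := by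
  have hN : N = r + (m + r) := by simpa using (Fintype.card_congr e).symm
  apply Fin.ext
  rw [Fin.val_rev, hstd, hstd]
  simp only [Sum.elim_inr, Sum.elim_inl, Fin.val_rev]
  omega

/-- **Mirror labels for any kernel**: `label(rev k) = rev (label k)` (hyperbolic slots by ★ `wittBlockOn_eq_rev_of_wittFormOn_ne_zero` — `W_{k, rev k} = 1` there —,
kernel slots carry the self-dual label `L`). [cite: Borel1991, §23] -/
theorem wittBlockOn_rev'
    (hstd : ∀ x, (e x).val = Sum.elim (fun i : Fin r => i.val) (Sum.elim (fun u : Fin m => r + u.val) (fun j : Fin r => r + m + j.val)) x) (k : Fin N) :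
    wittBlockOn e S (Fin.rev k) = Fin.rev (wittBlockOn e S k) := by
  -- any kernel matrix will do to witness `W_{e_t, rev e_t} = 1 ≠ 0`; take `0` over `ℤ`
  have hinl : ∀ t : Fin r, wittBlockOn e S (Fin.rev (e (Sum.inl t))) = Fin.rev (wittBlockOn e S (e (Sum.inl t))) := fun t =>
    wittBlockOn_eq_rev_of_wittFormOn_ne_zero e S (0 : Matrix (Fin m) (Fin m) ℤ) _ _
      (by rw [wittFormOn_apply_inl e hstd (0 : Matrix (Fin m) (Fin m) ℤ), if_pos rfl]; exact one_ne_zero)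
  obtain ⟨x, rfl⟩ := e.surjective k
  rcases x with t | u | j
  · exact hinl t
  · rw [rev_apply_inr_inl' e hstd]
    apply Fin.ext
    rw [Fin.val_rev, wittBlockOn_apply, wittBlockOn_apply, wittBlock_val, wittBlock_val, e.symm_apply_apply, e.symm_apply_apply]
    change (Finset.univ \ S).card = 2 * (Finset.univ \ S).card + 1 - ((Finset.univ \ S).card + 1)
    omega
  · have h := hinl (Fin.rev j)
    rw [rev_apply_inl e hstd, Fin.rev_rev] at h
    rw [rev_apply_inr_inr e hstd, h, Fin.rev_rev]

/-- **Block constancy from steps, any kernel**: a function `F : Fin N → ℤ` with `F(e_t) = F(e_{t+1})` across every `t ∈ S`, `F(e_{r-1}) = 0` if `r - 1 ∈ S`,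
`F = 0` on the kernel slots and `F ∘ rev = -F` is CONSTANT ON THE `S`-BLOCKS (standard `e`, any `m`; ★ `const_on_blocks_of_steps` without `W = J₀`).
[cite: Borel1991, §23] [cite: BernsteinZelevinsky1977, §2.1] -/
theorem const_on_blocks_of_steps'
    (hstd : ∀ x, (e x).val = Sum.elim (fun i : Fin r => i.val) (Sum.elim (fun u : Fin m => r + u.val) (fun j : Fin r => r + m + j.val)) x)
    (F : Fin N → ℤ)
    (h1 : ∀ (t : ℕ) (ht : t + 1 < r), (⟨t, by omega⟩ : Fin r) ∈ S → F (e (Sum.inl ⟨t, by omega⟩)) = F (e (Sum.inl ⟨t + 1, ht⟩)))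
    (h2 : ∀ (hr : 0 < r), (⟨r - 1, by omega⟩ : Fin r) ∈ S → F (e (Sum.inl ⟨r - 1, by omega⟩)) = 0)
    (h3 : ∀ u : Fin m, F (e (Sum.inr (Sum.inl u))) = 0) (h4 : ∀ k, F (Fin.rev k) = -F k) :
    ∀ i j : Fin N, wittBlockOn e S i = wittBlockOn e S j → F i = F j := by
  -- `e`-indices with equal labels
  have hee : ∀ t t' : Fin r, t ≤ t' → wittBlockNat (m := m) S (Sum.inl t) = wittBlockNat (m := m) S (Sum.inl t') →
      F (e (Sum.inl t)) = F (e (Sum.inl t')) := by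
    intro t t' htt' hlab
    have hS := mem_of_wittBlockNat_inl_eq (m := m) S htt' hlab
    -- induction on the distance
    have key : ∀ d : ℕ, ∀ (a : ℕ) (ha : a + d < r), t.val ≤ a → a + d ≤ t'.val →
        F (e (Sum.inl ⟨a, by omega⟩)) = F (e (Sum.inl ⟨a + d, ha⟩)) := by
      intro d
      induction d with
      | zero => intro a ha _ _; rfl
      | succ d ih =>
        intro a ha h1a h2a
        rw [ih a (by omega) h1a (by omega)]
        have := h1 (a + d) (by omega) (hS ⟨a + d, by omega⟩ (Fin.le_iff_val_le_val.2 (by simp; omega)) (Fin.lt_def.2 (by simp; omega)))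
        rw [this]
        rfl
    have := key (t'.val - t.val) t.val (by have := t'.isLt; have := Fin.le_iff_val_le_val.1 htt'; omega) le_rfl
      (by have := Fin.le_iff_val_le_val.1 htt'; omega)
    have ht : (⟨t.val, by omega⟩ : Fin r) = t := Fin.ext rfl
    have ht' : (⟨t.val + (t'.val - t.val), by have := t'.isLt; have := Fin.le_iff_val_le_val.1 htt'; omega⟩ : Fin r) = t' :=
      Fin.ext (by have := Fin.le_iff_val_le_val.1 htt'; change t.val + (t'.val - t.val) = t'.val; omega)
    rw [ht, ht'] at this
    exact this
  -- `e`-indices with the middle label `L`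
  have heL : ∀ t : Fin r, wittBlockNat (m := m) S (Sum.inl t) = (Finset.univ \ S).card → F (e (Sum.inl t)) = 0 := by
    intro t hlab
    have hS := mem_of_wittBlockNat_inl_eq_card (m := m) S hlab
    have hr : 0 < r := Fin.pos t
    have hlast : wittBlockNat (m := m) S (Sum.inl ⟨r - 1, by omega⟩) = (Finset.univ \ S).card := by
      refine le_antisymm (wittBlockNat_inl_le_card (m := m) S _) ?_
      rw [← hlab]
      exact wittBlockNat_mono_pos S (by change t.val ≤ r - 1; have := t.isLt; omega)
    rw [hee t ⟨r - 1, by omega⟩ (Fin.le_iff_val_le_val.2 (by have := t.isLt; change t.val ≤ r - 1; omega)) (hlab.trans hlast.symm)]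
    exact h2 hr (hS _ (Fin.le_iff_val_le_val.2 (by have := t.isLt; change t.val ≤ r - 1; omega)))
  -- labels as naturals; mirror
  have hval : ∀ k : Fin N, (wittBlockOn e S k).val = wittBlockNat S (e.symm k) := fun k => rfl
  have hrev : ∀ k : Fin N, (wittBlockOn e S (Fin.rev k)).val = 2 * (Finset.univ \ S).card - (wittBlockOn e S k).val := fun k => by
    rw [wittBlockOn_rev' e S hstd k, Fin.val_rev]; omega
  have hmidL : ∀ u : Fin m, wittBlockNat (m := m) S (Sum.inr (Sum.inl u)) = (Finset.univ \ S).card := fun u => rfl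
  have heLe : ∀ t : Fin r, wittBlockNat (m := m) S (Sum.inl t) ≤ (Finset.univ \ S).card := fun t => wittBlockNat_inl_le_card S t
  -- `f`-slot `j` is the mirror of `e_{rev j}`
  have hf : ∀ j : Fin r, e (Sum.inr (Sum.inr j)) = Fin.rev (e (Sum.inl (Fin.rev j))) := fun j => by
    rw [rev_apply_inl e hstd, Fin.rev_rev]
  intro i j hij
  obtain ⟨x, rfl⟩ := e.surjective i
  obtain ⟨y, rfl⟩ := e.surjective j
  have hijv := congrArg Fin.val hij
  rw [hval, hval, e.symm_apply_apply, e.symm_apply_apply] at hijv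
  rcases x with t | u | jx <;> rcases y with t' | u' | jy
  · rcases le_total t t' with h | h
    · exact hee t t' h hijv
    · exact (hee t' t h hijv.symm).symm
  · rw [hmidL] at hijv; rw [heL t hijv, h3]
  · -- `e_t` vs `f_{jy}`: both labels are `L`
    have h' := hrev (e (Sum.inl (Fin.rev jy)))
    rw [← hf, hval, hval, e.symm_apply_apply, e.symm_apply_apply] at h'
    have hLt : wittBlockNat (m := m) S (Sum.inl t) = (Finset.univ \ S).card := by
      have := heLe t; have := heLe (Fin.rev jy); omega
    have hLj : wittBlockNat (m := m) S (Sum.inl (Fin.rev jy)) = (Finset.univ \ S).card := by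
      have := heLe t; have := heLe (Fin.rev jy); omega
    rw [heL t hLt, hf, h4, heL _ hLj, neg_zero]
  · rw [hmidL] at hijv; rw [heL t' hijv.symm, h3]
  · rw [h3, h3]
  · have h' := hrev (e (Sum.inl (Fin.rev jy)))
    rw [← hf, hval, hval, e.symm_apply_apply, e.symm_apply_apply] at h'
    rw [hmidL] at hijv
    have hLj : wittBlockNat (m := m) S (Sum.inl (Fin.rev jy)) = (Finset.univ \ S).card := by
      have := heLe (Fin.rev jy); omega
    rw [h3, hf, h4, heL _ hLj, neg_zero]
  · have h' := hrev (e (Sum.inl (Fin.rev jx)))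
    rw [← hf, hval, hval, e.symm_apply_apply, e.symm_apply_apply] at h'
    have hLt : wittBlockNat (m := m) S (Sum.inl t') = (Finset.univ \ S).card := by
      have := heLe t'; have := heLe (Fin.rev jx); omega
    have hLj : wittBlockNat (m := m) S (Sum.inl (Fin.rev jx)) = (Finset.univ \ S).card := by
      have := heLe t'; have := heLe (Fin.rev jx); omega
    rw [heL t' hLt, hf, h4, heL _ hLj, neg_zero]
  · have h' := hrev (e (Sum.inl (Fin.rev jx)))
    rw [← hf, hval, hval, e.symm_apply_apply, e.symm_apply_apply] at h'
    rw [hmidL] at hijv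
    have hLj : wittBlockNat (m := m) S (Sum.inl (Fin.rev jx)) = (Finset.univ \ S).card := by
      have := heLe (Fin.rev jx); omega
    rw [h3, hf, h4, heL _ hLj, neg_zero]
  · -- two `f`-slots: mirror of two `e`-indices
    have hx' := hrev (e (Sum.inl (Fin.rev jx)))
    have hy' := hrev (e (Sum.inl (Fin.rev jy)))
    rw [← hf, hval, hval, e.symm_apply_apply, e.symm_apply_apply] at hx' hy'
    have hlab : wittBlockNat (m := m) S (Sum.inl (Fin.rev jx)) = wittBlockNat (m := m) S (Sum.inl (Fin.rev jy)) := by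
      have := heLe (Fin.rev jx); have := heLe (Fin.rev jy); omega
    rw [hf jx, hf jy, h4, h4]
    rcases le_total (Fin.rev jx) (Fin.rev jy) with h | h
    · rw [hee _ _ h hlab]
    · rw [hee _ _ h hlab.symm]


end Group

end Summit.HodgeConjecture.HodgeConjecture.Cruxes.H413.K2E3WittLeviConeCentreKernel

end
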